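import Literature.AnabelianGeometry.AbsoluteAnabelian.AbsTopIII.KummerPUKerProofs
import Literature.AnabelianGeometry.AbsoluteAnabelian.AbsTopIII.Thm19CuspidalDegreeUnique
import Literature.AnabelianGeometry.AbsoluteAnabelian.AbsTopIII.GeometricCyclotomeInnerProofs
import HarnessLib

/-!
# [AbsTopIII] Prop. 1.6 (iii), kernel form: the (⇒) half from Prop. 1.4 (i) and the weight law
# (proof-only companion of `KummerPU.lean` / `KummerPUKerProofs.lean`)

Mochizuki, *Topics in Absolute Anabelian Geometry III*, §1, Prop. 1.6 (iii) p. 35 (manuscript pages,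
lit key `paper:url-5493eb38cbb7`): "Suppose that `U = X ∖ S`, where `S ⊆ X(k)` is a finite subset. Then
restricting cohomology classes of `Π_U` to the various `I_x` for `x ∈ S` yields a natural exact sequence
`1 → (k^×)^∧ → H¹(Π_U, M_X) → ⊕_{x ∈ S} Ẑ`".  In the tree the named fact is
`IntrinsicKummerModel.Prop_1_6_iii_ker` (FACT-LIST F-0378): for `η ∈ H¹(Π_U, M_X(Ẑ))`,
(∀ cusps `c`, `η|_{I_c} = 0`) ⟺ `η ∈ Ker(res_{Δ_U})` (`galoisClasses`).  abc-iut-f-085 proved the (⇐)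
half for every model and split the fact (`prop_1_6_iii_ker_iff_mp`: the fact is equivalent to its (⇒)
half); the universal closure is refuted (`IntrinsicKummerModel.not_forall_prop_1_6_iii_ker`).

THIS FILE proves the (⇒) half — hence the whole named fact — AT EVERY MODEL from exactly two inputs,
following the printed mechanism (exactness in the middle: a class unramified at the cusps comes from
`Π_X`, and `H¹(Π_X, M_X) → H¹(Δ_X, M_X)^{G_k} = Hom_{G_k}(Δ_X^{ab}, Ẑ(1)) = T(J_X)(k) = 0` over a
Kummer-faithful `k`):

* Prop. 1.4 (i), second clause, relative to the model — the typed named fact `CurveModel.Prop_1_4_i'`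
  (FACT-LIST F-0340; `Π_U ↠ Π_X` surjective with kernel the closed normal subgroup generated by cuspidal
  inertia groups), taken as a hypothesis BY NAME;
* the WEIGHT LAW of the proper curve `X` over the Kummer-faithful base (interface law of a genuine
  model, carried as an explicit binder, no new `Prop` fact): every continuous crossed homomorphism
  `Π_X → M_X(Ẑ)` vanishes on `Δ_X`, i.e. `H¹(Π_X, M_X) → H¹(Δ_X, M_X)` is zero (print: weights /
  `T(J_X)(k) = 0` by Def. 1.5 (a) for the Jacobian; cf. [AbsTopI] Lemma 4.5 (iii)).

Mechanism (Mathlib's `continuousCohomology`, via the tree's crossed-homomorphism description of `H¹`,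
[cite: SerreGaloisCohomology1997, I §2.3]): write `η = [F]` for a continuous crossed homomorphism
`F : Π_U → M_X`; `η|_{I_c} = 0` and the triviality of the `Δ_U`-action on `M_X`
(`cyclotomeModRep_of_mem_geom`) give `F|_{I_c} = 0`; the zero set of `F` inside `Δ_U` is a closed
normal subgroup of `Π_U` (crossed-homomorphism identity `F(g d g⁻¹) = g · F(d)` for `d ∈ Δ_U`), so `F`
kills `Ker(Π_U ↠ Π_X)`; `F` descends along the quotient map `Π_U ↠ Π_X` to a continuous crossed
homomorphism `F̄ : Π_X → M_X`; the weight law kills `F̄|_{Δ_X}`, hence `F|_{Δ_U} = 0`, hence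
`res_{Δ_U} η = 0`.

All declarations are theorems; no definition, no instance, frozen files untouched.  HONEST FRAMING:
typed ≠ proved for genuine curves (no étale `π₁` in the tree; the weight law is a binder); nothing here
bears on [IUTchIII] Cor. 3.12.
-/

noncomputable section

open CategoryTheory ContinuousCohomology Topology
open scoped Classical Pointwise

namespace Literature.AnabelianGeometry.AbsoluteAnabelian.AbsTopIII

universe u

/-! ### `M_X(Λ)` is Hausdorff -/

/-- `M_X(Λ) = Hom(H²(Δ_X, Λ), Λ)` with the topology of pointwise convergence is Hausdorff when `Λ` is
(the evaluation map into `Λ^{H²(Δ_X, Λ)}` is an injective inducing map).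
[cite: MochizukiAbsTopIII2015, Prop 1.4 (ii) p.31] -/
theorem CyclotomeMod.t2Space (E : FundamentalExtension.{u}) (Λ : Type u) [AddCommGroup Λ]
    [TopologicalSpace Λ] [IsTopologicalAddGroup Λ] [T2Space Λ] : T2Space (CyclotomeMod E Λ) := by
  have hinj : Function.Injective (CyclotomeMod.evalHom E Λ) := by
    intro m m' h
    have h' : m.toDual = m'.toDual := LinearMap.ext fun ξ => congrFun h ξ
    exact h'
  exact (⟨⟨rfl⟩, hinj⟩ : IsEmbedding (CyclotomeMod.evalHom E Λ)).t2Space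

/-! ### Generic: crossed homomorphisms `Π_U → M_X(Λ)` along a morphism of extensions `r : Π_U → Π_X` -/

section Generic

variable {E' E : FundamentalExtension.{u}} (r : E' ⟶ E) (Λ : Type u) [AddCommGroup Λ]
  [TopologicalSpace Λ] [IsTopologicalAddGroup Λ]

/-- `Δ_U` acts trivially on `M_X(Λ)` (it maps into `Δ_X`, `Hom.mapsTo_geom`, which acts trivially,
`cyclotomeModRep_of_mem_geom`). [cite: MochizukiAbsTopIII2015, Prop 1.4 (ii) p.31] -/
theorem res_cyclotomeMod_ρ_apply_of_mem_geom {g : E'.arith} (hg : g ∈ E'.geom)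
    (m : TopRep.res (r.arith : E'.arith →* E.arith) (cyclotomeModTopRep E Λ)) :
    (TopRep.res (r.arith : E'.arith →* E.arith) (cyclotomeModTopRep E Λ)).ρ g m = m :=
  cyclotomeModRep_of_mem_geom E Λ (r.mapsTo_geom hg) m

/-- **A restriction class that vanishes forces the crossed homomorphism to vanish**: if `F : Π_U → M_X`
is a continuous crossed homomorphism and the restriction of `[F]` to a subgroup `I ≤ Δ_U` is `0`, then
`F|_I = 0` — because `I` acts trivially on `M_X`, so `H¹(I, M_X) = Hom_cont(I, M_X)`
(`eq_zero_of_crossedHomClass_eq_zero`). [cite: MochizukiAbsTopIII2015, Prop 1.6 (iii) p.35] -/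
theorem crossedHom_apply_eq_zero_of_res_eq_zero
    (F : C(E'.arith, TopRep.res (r.arith : E'.arith →* E.arith) (cyclotomeModTopRep E Λ)))
    (hF : ∀ x y, F (x * y) =
      F x + (TopRep.res (r.arith : E'.arith →* E.arith) (cyclotomeModTopRep E Λ)).ρ x (F y))
    {I : Subgroup E'.arith} (hI : I ≤ E'.geom)
    (h0 : cyclotomeModH1Res r Λ I
      (crossedHomClass (TopRep.res (r.arith : E'.arith →* E.arith) (cyclotomeModTopRep E Λ)) F hF) = 0) :
    ∀ i ∈ I, F i = 0 := by
  have htriv : ∀ (i : I) (x : TopRep.res (subgroupInclusion I : I →* E'.arith)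
      (TopRep.res (r.arith : E'.arith →* E.arith) (cyclotomeModTopRep E Λ))),
      (TopRep.res (subgroupInclusion I : I →* E'.arith)
        (TopRep.res (r.arith : E'.arith →* E.arith) (cyclotomeModTopRep E Λ))).ρ i x = x :=
    fun i x => cyclotomeModRep_of_mem_geom E Λ (r.mapsTo_geom (hI i.2)) x
  have h1 := map_crossedHomClass (subgroupInclusion I)
    (𝟙 (TopRep.res (subgroupInclusion I : I →* E'.arith)
      (TopRep.res (r.arith : E'.arith →* E.arith) (cyclotomeModTopRep E Λ)))) F hF
  have h2 : (ContinuousCohomology.map (subgroupInclusion I)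
      (𝟙 (TopRep.res (subgroupInclusion I : I →* E'.arith)
        (TopRep.res (r.arith : E'.arith →* E.arith) (cyclotomeModTopRep E Λ)))) 1).hom
      (crossedHomClass _ F hF) = 0 := h0
  rw [h1] at h2
  have h3 := eq_zero_of_crossedHomClass_eq_zero _ htriv _ _ h2
  intro i hi
  have h4 := congrArg (fun f => f ⟨i, hi⟩) h3
  exact h4

/-- **The zero set of a crossed homomorphism inside `Δ_U` absorbs closed normal closures**: if a
continuous crossed homomorphism `F : Π_U → M_X(Λ)` (`Λ` Hausdorff) vanishes on a subset `T ⊆ Δ_U`, it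
vanishes on the closed normal subgroup of `Π_U` generated by `T` — `{d ∈ Δ_U | F d = 0}` is a closed
subgroup (`Δ_U` acts trivially) which is normal by the identity `F(g d g⁻¹) = g · F(d)`.
[cite: MochizukiAbsTopIII2015, Prop 1.6 (iii) p.35] -/
theorem crossedHom_apply_eq_zero_of_mem_closure_normalClosure [T2Space Λ]
    (F : C(E'.arith, TopRep.res (r.arith : E'.arith →* E.arith) (cyclotomeModTopRep E Λ)))
    (hF : ∀ x y, F (x * y) =
      F x + (TopRep.res (r.arith : E'.arith →* E.arith) (cyclotomeModTopRep E Λ)).ρ x (F y))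
    {T : Set E'.arith} (hT : T ⊆ E'.geom) (hFT : ∀ t ∈ T, F t = 0) {g : E'.arith}
    (hg : g ∈ (Subgroup.normalClosure T).topologicalClosure) : F g = 0 := by
  haveI : T2Space (TopRep.res (r.arith : E'.arith →* E.arith) (cyclotomeModTopRep E Λ)) :=
    CyclotomeMod.t2Space E Λ
  -- the subgroup `W = {d ∈ Δ_U | F d = 0}`
  let W : Subgroup E'.arith :=
    { carrier := {d | d ∈ E'.geom ∧ F d = 0}
      mul_mem' := by
        rintro a b ⟨ha, hFa⟩ ⟨hb, hFb⟩
        refine ⟨mul_mem ha hb, ?_⟩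
        rw [hF, hFa, hFb, map_zero, add_zero]
      one_mem' := ⟨one_mem _, crossedHom_map_one _ F hF⟩
      inv_mem' := by
        rintro a ⟨ha, hFa⟩
        refine ⟨inv_mem ha, ?_⟩
        have h := hF a a⁻¹
        rw [mul_inv_cancel, crossedHom_map_one _ F hF, hFa, zero_add,
          res_cyclotomeMod_ρ_apply_of_mem_geom r Λ ha] at h
        exact h.symm }
  have hWn : W.Normal := by
    refine ⟨fun d hd x => ?_⟩
    obtain ⟨hd, hFd⟩ := hd
    refine ⟨E'.normal_geom.conj_mem d hd x, ?_⟩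
    have key : F (x * d * x⁻¹) = F (x * x⁻¹) := by
      rw [mul_assoc, hF x (d * x⁻¹), hF d x⁻¹, hFd, zero_add,
        res_cyclotomeMod_ρ_apply_of_mem_geom r Λ hd, hF x x⁻¹]
    show F (x * d * x⁻¹) = 0
    rw [key, mul_inv_cancel, crossedHom_map_one _ F hF]
  have hle : Subgroup.normalClosure T ≤ W := by
    haveI := hWn
    exact Subgroup.normalClosure_le_normal fun t ht => ⟨hT ht, hFT t ht⟩
  have hWc : IsClosed (W : Set E'.arith) := by
    have hset : (W : Set E'.arith) = (E'.geom : Set E'.arith) ∩ F ⁻¹' {0} :=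
      Set.ext fun _ => Iff.rfl
    rw [hset]
    exact E'.isClosed_geom.inter (isClosed_singleton.preimage F.continuous)
  exact (Subgroup.topologicalClosure_minimal _ hle hWc hg).2

/-- **Descent of a crossed homomorphism along `Π_U ↠ Π_X`**: a continuous crossed homomorphism
`F : Π_U → M_X(Λ)` (for the action through `r`) that kills `Ker(r)` is `F̄ ∘ r` for a continuous crossed
homomorphism `F̄ : Π_X → M_X(Λ)`, provided `r : Π_U → Π_X` is surjective (then it is a quotient map:
`Π_U` compact, `Π_X` Hausdorff) — inflation at the level of crossed homomorphisms.
[cite: MochizukiAbsTopIII2015, Prop 1.6 (iii) p.35] -/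
theorem exists_crossedHom_descend (hsurj : Function.Surjective r.arith)
    (F : C(E'.arith, TopRep.res (r.arith : E'.arith →* E.arith) (cyclotomeModTopRep E Λ)))
    (hF : ∀ x y, F (x * y) =
      F x + (TopRep.res (r.arith : E'.arith →* E.arith) (cyclotomeModTopRep E Λ)).ρ x (F y))
    (hker : ∀ g, r.arith g = 1 → F g = 0) :
    ∃ Fb : C(E.arith, cyclotomeModTopRep E Λ),
      (∀ x y, Fb (x * y) = Fb x + (cyclotomeModTopRep E Λ).ρ x (Fb y)) ∧
        ∀ g, Fb (r.arith g) = F g := by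
  -- `F` is constant on the fibres of `r`
  have hfib : ∀ a b, r.arith a = r.arith b → F a = F b := by
    intro a b hab
    have hk : r.arith (a⁻¹ * b) = 1 := by
      rw [map_mul, map_inv, hab, inv_mul_cancel]
    symm
    calc F b = F (a * (a⁻¹ * b)) := by rw [mul_inv_cancel_left]
      _ = F a + (TopRep.res (r.arith : E'.arith →* E.arith) (cyclotomeModTopRep E Λ)).ρ a
            (F (a⁻¹ * b)) := hF _ _
      _ = F a := by rw [hker _ hk, map_zero, add_zero]
  let s : E.arith → E'.arith := Function.surjInv hsurj
  have hs : ∀ y, r.arith (s y) = y := Function.surjInv_eq hsurj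
  let Fb : E.arith → CyclotomeMod E Λ := fun y => F (s y)
  have hFb : ∀ g, Fb (r.arith g) = F g := fun g => hfib _ _ (hs (r.arith g))
  have hcont : Continuous Fb := by
    have hq : IsQuotientMap r.arith :=
      ((map_continuous r.arith).isClosedMap).isQuotientMap (map_continuous r.arith) hsurj
    rw [hq.continuous_iff]
    have hcomp : Fb ∘ r.arith = F := funext hFb
    rw [hcomp]
    exact F.continuous
  refine ⟨⟨Fb, hcont⟩, fun x y => ?_, hFb⟩
  obtain ⟨a, rfl⟩ := hsurj x
  obtain ⟨b, rfl⟩ := hsurj y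
  show Fb (r.arith a * r.arith b) =
    Fb (r.arith a) + (cyclotomeModTopRep E Λ).ρ (r.arith a) (Fb (r.arith b))
  rw [← map_mul, hFb, hFb, hFb, hF]
  rfl

/-- **Core of Prop. 1.6 (iii) (⇒) for intrinsic coefficients**: let `r : Π_U → Π_X` be a morphism of
extensions with `Π_U ↠ Π_X` surjective and kernel the closed normal subgroup generated by a family of
subgroups `I_c ≤ Δ_U` (`c ∈ S`) — the shape of Prop. 1.4 (i) — and assume the WEIGHT LAW for `X`:
every continuous crossed homomorphism `Π_X → M_X(Λ)` vanishes on `Δ_X` (`H¹(Π_X, M_X) → H¹(Δ_X, M_X)`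
is zero).  Then a class `η ∈ H¹(Π_U, M_X(Λ))` whose restriction to every `I_c` vanishes has vanishing
restriction to `Δ_U`. [cite: MochizukiAbsTopIII2015, Prop 1.6 (iii) p.35] -/
theorem cyclotomeModH1Res_geom_eq_zero_of_weightLaw [T2Space Λ]
    (hsurj : Function.Surjective r.arith) {ι : Type u} (I : ι → Subgroup E'.arith)
    (hI : ∀ c, I c ≤ E'.geom) {S : Set ι}
    (hker : r.arith.toMonoidHom.ker =
      (Subgroup.normalClosure (⋃ c ∈ S, (I c : Set E'.arith))).topologicalClosure)
    (hW : ∀ (Fb : C(E.arith, cyclotomeModTopRep E Λ)),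
      (∀ x y, Fb (x * y) = Fb x + (cyclotomeModTopRep E Λ).ρ x (Fb y)) → ∀ d ∈ E.geom, Fb d = 0)
    (η : cyclotomeModH1 r Λ) (hη : ∀ c, cyclotomeModH1Res r Λ (I c) η = 0) :
    cyclotomeModH1Res r Λ E'.geom η = 0 := by
  obtain ⟨F, hF, rfl⟩ :=
    exists_crossedHomClass_eq (TopRep.res (r.arith : E'.arith →* E.arith) (cyclotomeModTopRep E Λ)) η
  -- `F` vanishes on each `I_c`
  have hFI : ∀ c, ∀ i ∈ I c, F i = 0 := fun c =>
    crossedHom_apply_eq_zero_of_res_eq_zero r Λ F hF (hI c) (hη c)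
  -- hence on `Ker(Π_U ↠ Π_X)`
  have hFker : ∀ g, r.arith g = 1 → F g = 0 := by
    intro g hg
    have hg' : g ∈ (Subgroup.normalClosure (⋃ c ∈ S, (I c : Set E'.arith))).topologicalClosure := by
      rw [← hker]
      exact hg
    refine crossedHom_apply_eq_zero_of_mem_closure_normalClosure r Λ F hF ?_ ?_ hg'
    · intro t ht
      obtain ⟨c, -, htc⟩ := Set.mem_iUnion₂.1 ht
      exact hI c htc
    · intro t ht
      obtain ⟨c, -, htc⟩ := Set.mem_iUnion₂.1 ht
      exact hFI c t htc
  -- descend to `Π_X` and apply the weight law there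
  obtain ⟨Fb, hFb, hFbF⟩ := exists_crossedHom_descend r Λ hsurj F hF hFker
  have hFΔ : ∀ d ∈ E'.geom, F d = 0 := fun d hd => by
    rw [← hFbF d]
    exact hW Fb hFb _ (r.mapsTo_geom hd)
  -- the restricted class is the class of `F|_{Δ_U} = 0`
  have h1 := map_crossedHomClass (subgroupInclusion E'.geom)
    (𝟙 (TopRep.res (subgroupInclusion E'.geom : E'.geom →* E'.arith)
      (TopRep.res (r.arith : E'.arith →* E.arith) (cyclotomeModTopRep E Λ)))) F hF
  show (ContinuousCohomology.map (subgroupInclusion E'.geom)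
    (𝟙 (TopRep.res (subgroupInclusion E'.geom : E'.geom →* E'.arith)
      (TopRep.res (r.arith : E'.arith →* E.arith) (cyclotomeModTopRep E Λ)))) 1).hom
      (crossedHomClass _ F hF) = 0
  rw [h1, crossedHomClass_eq_zero_iff]
  refine ⟨0, ?_, fun g => ?_⟩
  · simp only [map_zero]
    exact continuous_const
  · rw [map_zero, sub_zero]
    exact hFΔ g g.2

end Generic

/-! ### Prop. 1.6 (iii), kernel form, at every `M : IntrinsicKummerModel` -/

namespace IntrinsicKummerModel

variable (M : IntrinsicKummerModel.{u})

/-- **The (⇒) half of `Prop_1_6_iii_ker` at every model, from Prop. 1.4 (i) BY NAME and the weight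
law of `X`**: for `U ⊆ X` a cofinite open with `U`, `X` scheme-like, `X` proper, over a Kummer-faithful
`k`, a class `η ∈ H¹(Π_U, M_X(Ẑ))` with `η|_{I_c} = 0` for every cusp `c` of `U` is a Galois class
(`η ∈ Ker(res_{Δ_U})`).  Inputs: `h14 : M.toCurveModel.Prop_1_4_i'` (F-0340, the typed second clause of
Prop. 1.4 (i): `Π_U ↠ Π_X` surjective, kernel topologically normally generated by cuspidal inertia
groups) and the weight law `hW` («every continuous crossed homomorphism `Π_X → M_X(Ẑ)` vanishes on `Δ_X`»,
print p. 35: `Hom_{G_k}(Δ_X^{ab}, M_X) = T(J_X)(k) = 0` for `X` proper over a Kummer-faithful `k`; a law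
of the genuine étale-`π₁` model, where `M.base U = M.base X`, carried as a binder).  The genus and
cusp-rationality hypotheses of the named fact are not used for this half.
[cite: MochizukiAbsTopIII2015, Prop 1.6 (iii) p.35] -/
theorem prop_1_6_iii_ker_mp_of_prop_1_4_i'_of_weightLaw
    (h14 : M.toCurveModel.Prop_1_4_i')
    (hW : ∀ (U X : M.Curve) (_ : M.IsCofiniteOpen U X), M.IsProper X → M.IsScheme X →
      IsKummerFaithful (M.base U) →
      ∀ (Fb : C((M.ext X).arith, cyclotomeModTopRep (M.ext X) ZHatCoeff.{u})),
        (∀ x y, Fb (x * y) = Fb x + (cyclotomeModTopRep (M.ext X) ZHatCoeff.{u}).ρ x (Fb y)) →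
        ∀ d ∈ (M.ext X).geom, Fb d = 0) :
    ∀ (U X : M.Curve) (h : M.IsCofiniteOpen U X) (hX : M.IsProper X), M.IsScheme U → M.IsScheme X →
      2 ≤ M.genus X → IsKummerFaithful (M.base U) →
        (∀ c : (M.cusps U).Cusp, (M.cusps U).IsRational c) →
          ∀ η : cyclotomeModH1 (M.res h) ZHatCoeff.{u},
            (∀ c : (M.cusps U).Cusp, M.classRes h ((M.cusps U).Icusp c) η = 0) →
              η ∈ M.galoisClasses h := by
  intro U X h hX hU hXs _hg hk _hrat η hη
  obtain ⟨hsurj, -, S, hker⟩ := h14 U X h hU hXs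
  rw [M.mem_galoisClasses_iff h η]
  exact cyclotomeModH1Res_geom_eq_zero_of_weightLaw (M.res h) ZHatCoeff.{u} hsurj
    (fun c => (M.cusps U).Icusp c) (fun c => M.icusp_le_geom U c) hker (hW U X h hX hXs hk) η hη

/-- **`Prop_1_6_iii_ker M` at every model from Prop. 1.4 (i) BY NAME and the weight law** (FACT-LIST
F-0378: the (⇐) half is abc-iut-f-085's `prop_1_6_iii_ker_mpr`, the (⇒) half the preceding theorem,
assembled through the split `prop_1_6_iii_ker_iff_mp`). [cite: MochizukiAbsTopIII2015, Prop 1.6 (iii) p.35] -/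
theorem prop_1_6_iii_ker_of_prop_1_4_i'_of_weightLaw
    (h14 : M.toCurveModel.Prop_1_4_i')
    (hW : ∀ (U X : M.Curve) (_ : M.IsCofiniteOpen U X), M.IsProper X → M.IsScheme X →
      IsKummerFaithful (M.base U) →
      ∀ (Fb : C((M.ext X).arith, cyclotomeModTopRep (M.ext X) ZHatCoeff.{u})),
        (∀ x y, Fb (x * y) = Fb x + (cyclotomeModTopRep (M.ext X) ZHatCoeff.{u}).ρ x (Fb y)) →
        ∀ d ∈ (M.ext X).geom, Fb d = 0) :
    M.Prop_1_6_iii_ker :=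
  (M.prop_1_6_iii_ker_iff_mp).2 (M.prop_1_6_iii_ker_mp_of_prop_1_4_i'_of_weightLaw h14 hW)

end IntrinsicKummerModel

end Literature.AnabelianGeometry.AbsoluteAnabelian.AbsTopIII
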